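import Summits.HodgeConjecture.HodgeConjecture.Theorems.K2LiuGL2HeckePrimitiveSplit

/-!
# The number of left cosets in the primitive double coset `K diag(ϖ^{m+1}, 1) K` of `GL₂`: `(q+1) q^m`
# (LOCAL SEAM of s23, engine F2 of #28s — coset count)

Track B ∕ K2-LIT, hLiu418 = stmt-HodgeConjecture-24832; socket #28s `sig_K2LiuUnramifiedDoublingHeckeIdentity` (U5b ED. 3). Helper
(count-neutral, own head per LEAD R3), GENERIC over a valued field `F` with finite residue field `𝓀` (`q = #𝓀`), a uniformizing element
`ϖ`, `K = GL₂(𝒪)`: the SHARP count `#(K diag(ϖ^{m+1},1) K ∕ K) = (q+1)q^m` (Shimura Thm. 3.24 (6); Serre, *Trees* II.1.1), which is the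
growth rate `q^k` that makes the unramified doubling Hecke operator converge on the whole half-plane `Re s > 0` in #28s.

Route (no transversal is enumerated): ★ `K2LiuGL2HeckePrimitiveSplit.heckeOperator_zpowDiagGL_apply_eq_smul` applied to the TRIVIAL
representation, on which `[K g K]` acts by `#(K g K ∕ K)` (`heckeOperator_trivial_apply_one`), `[K z K]` by `1`, and `T₁` by `q + 1` — the
number of lines of `𝓀²`, obtained from ★ `HeckeLatticeCount.ncard_orbit_heckeDiag_isIntegralMatrix` (Shimura's lattice count, at `w = ϖ·1`)
and the Möbius identity ★ `Literature.LinearAlgebra.Subspace.sum_neg_one_pow_mul_pow_choose_mul_card_ge_codim_eq_zero`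
(`1 − #{lines} + q = 0`). Theorems only; no `sorry`. (★ `HeckeCosetCountGL.ncard_cosets_glIntDet_le_pow_mul` would give a cruder
`(m+1)²q^m`; that module is not built on the farm at the time of writing.) [ShimuraIATAF1971, Thm. 3.24 (6)]; [Macdonald1995, Ch. V (2.9)].
HONEST LABEL: HC_CM is proved only modulo the printed citations (2 remaining named inputs: hLiu418 = stmt-HodgeConjecture-24832, h413 =
stmt-HodgeConjecture-24833) until rung 0 closes; this file is unconditional and moves no counter.
-/

set_option autoImplicit false

set_option linter.dupNamespace false

noncomputable section

open scoped Pointwise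
open MulAction ValuativeRel Matrix

namespace Summit.HodgeConjecture.HodgeConjecture.Cruxes.HLiu418.K2LiuGL2PrimitiveCosetCount

open Literature.NumberTheory.Automorphic
open Summit.HodgeConjecture.HodgeConjecture.Cruxes.HLiu418.K2LiuGL2PrimitiveCosets
open Summit.HodgeConjecture.HodgeConjecture.Cruxes.HLiu418.K2LiuGL2HeckePrimitiveSplit

variable {F : Type*} [Field F] [ValuativeRel F] {ϖ : F}

/-! ## §1 Hecke operators on the trivial representation count cosets -/

/-- `1 ∈ ℚ` is fixed by every subgroup under the trivial representation. [cite: ShimuraIATAF1971, §3.1] -/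
theorem one_mem_fixedPoints_trivial {G : Type*} [Group G] (H : Subgroup G) :
    (1 : ℚ) ∈ (Representation.trivial ℚ G ℚ).fixedPoints H := by
  rw [Representation.mem_fixedPoints]
  intro g _
  rfl

/-- on the trivial representation `[K g K] · 1 = #(K g K ∕ K)`. [cite: ShimuraIATAF1971, §3.1 Prop. 3.3] -/
theorem heckeOperator_trivial_apply_one {G : Type*} [Group G] (K : Subgroup G) (g : G) (hfin : (orbit K (g : G ⧸ K)).Finite) :
    heckeOperator (Representation.trivial ℚ G ℚ) K g 1 = ((orbit K (g : G ⧸ K)).ncard : ℚ) := by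
  rw [heckeOperator_apply_eq_sum_out _ K g hfin (one_mem_fixedPoints_trivial K), Set.ncard_eq_toFinset_card _ hfin]
  simp

/-! ## §2 `#(K diag(ϖ,1) K ∕ K) = q + 1` -/

/-- the number of LINES of `𝓀²` is `q + 1` (Möbius function of the subspace lattice: `1 − N₁ + q = 0`).
[cite: ShimuraIATAF1971, Lemma 3.23] [cite: Macdonald1995, Ch. I §2 Ex. 3] -/
theorem card_submodule_finrank_add_one [Finite 𝓀[F]] :
    Nat.card {Y : Submodule 𝓀[F] (Fin 2 → 𝓀[F]) // (⊥ : Submodule 𝓀[F] (Fin 2 → 𝓀[F])) ≤ Y ∧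
      Module.finrank 𝓀[F] Y + 1 = Module.finrank 𝓀[F] (Fin 2 → 𝓀[F])} = Nat.card 𝓀[F] + 1 := by
  have hmob := Literature.LinearAlgebra.Subspace.sum_neg_one_pow_mul_pow_choose_mul_card_ge_codim_eq_zero
    (k := 𝓀[F]) (W := Fin 2 → 𝓀[F]) (C := ⊥) bot_ne_top
  have h0 := Literature.LinearAlgebra.Subspace.card_ge_codim_zero (k := 𝓀[F]) (W := Fin 2 → 𝓀[F]) (⊥ : Submodule 𝓀[F] (Fin 2 → 𝓀[F]))
  have hW : Module.finrank 𝓀[F] (Fin 2 → 𝓀[F]) = 2 := Module.finrank_fin_fun _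
  have h2 : Nat.card {Y : Submodule 𝓀[F] (Fin 2 → 𝓀[F]) // (⊥ : Submodule 𝓀[F] (Fin 2 → 𝓀[F])) ≤ Y ∧
      Module.finrank 𝓀[F] Y + 2 = Module.finrank 𝓀[F] (Fin 2 → 𝓀[F])} = 1 := by
    rw [Nat.card_eq_one_iff_unique]
    refine ⟨⟨fun Y Y' => Subtype.ext ?_⟩, ⟨⟨⊥, le_rfl, by rw [finrank_bot, hW]⟩⟩⟩
    have hY : Y.1 = ⊥ := Submodule.finrank_eq_zero.1 (by have := Y.2.2; omega)
    have hY' : Y'.1 = ⊥ := Submodule.finrank_eq_zero.1 (by have := Y'.2.2; omega)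
    rw [hY, hY']
  have e1 : Nat.card {Y : Submodule 𝓀[F] (Fin 2 → 𝓀[F]) // (⊥ : Submodule 𝓀[F] (Fin 2 → 𝓀[F])) ≤ Y ∧
      Module.finrank 𝓀[F] Y + 1 = Module.finrank 𝓀[F] (Fin 2 → 𝓀[F])} =
        Nat.card {Y : Submodule 𝓀[F] (Fin 2 → 𝓀[F]) // Module.finrank 𝓀[F] Y + 1 = 2} :=
    Nat.card_congr (Equiv.subtypeEquivRight fun Y => by rw [hW]; simp only [bot_le, true_and])
  rw [hW] at hmob h0 h2
  rw [show (2 : ℕ) + 1 = 3 from rfl, Finset.sum_range_succ, Finset.sum_range_succ, Finset.sum_range_one, h0, h2] at hmob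
  norm_num at hmob
  rw [e1]
  have : (Nat.card {Y : Submodule 𝓀[F] (Fin 2 → 𝓀[F]) // Module.finrank 𝓀[F] Y + 1 = 2} : ℤ) = Nat.card 𝓀[F] + 1 := by
    linarith
  exact_mod_cast this

/-- **`#(K diag(ϖ,1) K ∕ K) = q + 1`**: by Shimura's lattice count (★ `ncard_orbit_heckeDiag_isIntegralMatrix` at `w = ϖ·1`, where the
integrality condition is automatic) the cosets of `K t₁ K` are the lines of `𝓀²`. [cite: ShimuraIATAF1971, Lemma 3.22, Thm. 3.24 (6)] -/
theorem ncard_orbit_diag_one [Finite 𝓀[F]] (hϖ : IsUniformizingElement ϖ) :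
    (orbit (glInt 2 F) ((zpowDiagGL hϖ.ne_zero ![((1 : ℕ) : ℤ), 0] : GL (Fin 2) F) : GL (Fin 2) F ⧸ glInt 2 F)).ncard = Nat.card 𝓀[F] + 1 := by
  classical
  set z : GL (Fin 2) F := zpowDiagGL hϖ.ne_zero (fun _ : Fin 2 => (1 : ℤ)) with hzdef
  set w₀ : Matrix (Fin 2) (Fin 2) 𝒪[F] := Matrix.diagonal fun _ => (⟨ϖ, hϖ.mem⟩ : 𝒪[F]) with hw₀
  have hw : (z : Matrix (Fin 2) (Fin 2) F) = w₀.map (𝒪[F]).subtype := by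
    rw [hzdef, coe_zpowDiagGL, hw₀, Matrix.diagonal_map (map_zero _)]
    congr 1
    funext i
    simp
  have hcount := ncard_orbit_heckeDiag_isIntegralMatrix (n := 2) hϖ (r := 1) (by norm_num) w₀ hw
  -- the residue columns of `ϖ·1` vanish
  have hspan : Submodule.span 𝓀[F] (Set.range fun j : Fin 2 => fun i : Fin 2 => IsLocalRing.residue 𝒪[F] (w₀ i j)) = ⊥ := by
    rw [Submodule.span_eq_bot]
    rintro x ⟨j, rfl⟩
    funext i
    have hres : IsLocalRing.residue 𝒪[F] (⟨ϖ, hϖ.mem⟩ : 𝒪[F]) = 0 := by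
      rw [IsLocalRing.residue_eq_zero_iff, hϖ.span_eq]
      exact Ideal.mem_span_singleton_self _
    simp only [hw₀, Matrix.diagonal_apply, Pi.zero_apply]
    split_ifs
    · exact hres
    · exact map_zero _
  -- the integrality condition `α.out⁻¹ z ∈ M₂(𝒪)` holds on the whole orbit of `t₁ K`
  have hall : {α ∈ orbit (glInt 2 F) ((heckeDiag 2 (Units.mk0 ϖ hϖ.ne_zero) 1 : GL (Fin 2) F) : GL (Fin 2) F ⧸ glInt 2 F) |
      IsIntegralMatrix (((α.out)⁻¹ * z : GL (Fin 2) F) : Matrix (Fin 2) (Fin 2) F)} =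
        orbit (glInt 2 F) ((zpowDiagGL hϖ.ne_zero ![((1 : ℕ) : ℤ), 0] : GL (Fin 2) F) : GL (Fin 2) F ⧸ glInt 2 F) := by
    rw [heckeDiag_two_one hϖ, Nat.cast_one]
    ext α
    simp only [Set.mem_setOf_eq, and_iff_left_iff_imp]
    intro hα
    obtain ⟨κ₁, hκ₁, κ₂, hκ₂, h⟩ := DoubleCoset.mem_doubleCoset.1 (out_mem_doubleCoset_of_mem_orbit hα)
    have hrew : (α.out)⁻¹ * z = κ₂⁻¹ * (((zpowDiagGL hϖ.ne_zero ![(1 : ℤ), 0])⁻¹ * z) * κ₁⁻¹) := by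
      rw [h, _root_.mul_inv_rev, _root_.mul_inv_rev, mul_assoc, mul_assoc, glInt_mul_scalar_comm hϖ.ne_zero κ₁⁻¹ (inv_mem hκ₁), mul_assoc]
    rw [hrew, K2LiuGL2PrimitiveCosets.isIntegralMatrix_glInt_mul_iff (inv_mem hκ₂), isIntegralMatrix_mul_glInt_iff (inv_mem hκ₁), hzdef,
      ← zpowDiagGL_neg,
      ← zpowDiagGL_add]
    refine isIntegralMatrix_zpowDiagGL_of_nonneg hϖ fun i => ?_
    fin_cases i <;> simp
  rw [hall, hspan, card_submodule_finrank_eq_sub ⊥ (by norm_num : 1 ≤ 2)] at hcount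
  rw [hcount]
  exact card_submodule_finrank_add_one

/-! ## §3 `#(K diag(ϖ^{m+1},1) K ∕ K) = (q+1) q^m` -/

/-- **THE SHARP COSET COUNT OF THE PRIMITIVE DOUBLE COSETS**: `#(K diag(ϖ^{m+1}, 1) K ∕ K) = (q+1)·q^m` — the Hecke eigenvalues of the
trivial representation (`T₁ ↦ q+1`, `[K z K] ↦ 1`) through ★ `heckeOperator_zpowDiagGL_apply_eq_smul`.
[cite: ShimuraIATAF1971, Thm. 3.24 (6)] [cite: Macdonald1995, Ch. V (2.9)] -/
theorem ncard_orbit_diag_succ [Finite 𝓀[F]] [IsDiscreteValuationRing 𝒪[F]] (hϖ : IsUniformizingElement ϖ) (m : ℕ) :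
    (orbit (glInt 2 F) ((zpowDiagGL hϖ.ne_zero ![((m + 1 : ℕ) : ℤ), 0] : GL (Fin 2) F) : GL (Fin 2) F ⧸ glInt 2 F)).ncard =
      (Nat.card 𝓀[F] + 1) * Nat.card 𝓀[F] ^ m := by
  set ρ := Representation.trivial ℚ (GL (Fin 2) F) ℚ with hρ
  have hv := one_mem_fixedPoints_trivial (G := GL (Fin 2) F) (glInt 2 F)
  -- the two generator eigenvalues on the trivial representation
  have hT : heckeOperator ρ (glInt 2 F) (zpowDiagGL hϖ.ne_zero ![(1 : ℤ), 0]) 1 = ((Nat.card 𝓀[F] : ℚ) + 1) • (1 : ℚ) := by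
    have h := heckeOperator_trivial_apply_one (glInt 2 F) (zpowDiagGL hϖ.ne_zero ![((1 : ℕ) : ℤ), 0]) (finite_orbit_diag hϖ 1)
    rw [ncard_orbit_diag_one hϖ, Nat.cast_one] at h
    rw [hρ, h, smul_eq_mul, mul_one]
    push_cast
    rfl
  have hZ : heckeOperator ρ (glInt 2 F) (zpowDiagGL hϖ.ne_zero (fun _ : Fin 2 => (1 : ℤ))) 1 = (1 : ℚ) • (1 : ℚ) := by
    rw [heckeOperator_apply_of_comm ρ (glInt 2 F) (glInt_mul_scalar_comm hϖ.ne_zero) hv, one_smul]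
    rfl
  -- the closed form `e₀ = 1`, `e_{m+1} = (q+1) q^m` satisfies the Hecke recursion with `a₁ = q+1`, `ω = 1`
  set e : ℕ → ℚ := fun m => Nat.rec (motive := fun _ => ℚ) 1 (fun m _ => ((Nat.card 𝓀[F] : ℚ) + 1) * (Nat.card 𝓀[F] : ℚ) ^ m) m with hedef
  have he0 : e 0 = 1 := rfl
  have hes : ∀ m, e (m + 1) = ((Nat.card 𝓀[F] : ℚ) + 1) * (Nat.card 𝓀[F] : ℚ) ^ m := fun m => rfl
  have he1 : e 1 = (Nat.card 𝓀[F] : ℚ) + 1 := by have h := hes 0; rw [zero_add, pow_zero, mul_one] at h; exact h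
  have he2 : e 2 = ((Nat.card 𝓀[F] : ℚ) + 1) ^ 2 - ((Nat.card 𝓀[F] : ℚ) + 1) * 1 := by
    have h := hes 1; rw [show (1 : ℕ) + 1 = 2 from rfl, pow_one] at h; rw [h]; ring
  have hem := heckeOperator_zpowDiagGL_apply_eq_smul hϖ ρ hv hT hZ e he0 he1 he2 (fun m => by rw [hes, hes, hes]; ring) (m + 1)
  rw [heckeOperator_trivial_apply_one (glInt 2 F) _ (finite_orbit_diag hϖ (m + 1)), hes, smul_eq_mul, mul_one] at hem
  exact_mod_cast hem

/-- the count as a bound valid for every `m`: `#(K diag(ϖ^m,1) K ∕ K) ≤ 2 q^m`. [cite: ShimuraIATAF1971, Thm. 3.24 (6)] -/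
theorem ncard_orbit_diag_le [Finite 𝓀[F]] [IsDiscreteValuationRing 𝒪[F]] (hϖ : IsUniformizingElement ϖ) (m : ℕ) :
    (orbit (glInt 2 F) ((zpowDiagGL hϖ.ne_zero ![(m : ℤ), 0] : GL (Fin 2) F) : GL (Fin 2) F ⧸ glInt 2 F)).ncard ≤ 2 * Nat.card 𝓀[F] ^ m := by
  have hq : 1 ≤ Nat.card 𝓀[F] := Nat.one_le_iff_ne_zero.mpr (Nat.card_pos (α := 𝓀[F])).ne'
  rcases m with _ | m
  · -- `D(0) = 1`: a single coset
    rw [zpowDiagGL_zero_zero hϖ.ne_zero, pow_zero, mul_one]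
    have : orbit (glInt 2 F) ((1 : GL (Fin 2) F) : GL (Fin 2) F ⧸ glInt 2 F) = {((1 : GL (Fin 2) F) : GL (Fin 2) F ⧸ glInt 2 F)} := by
      ext γ
      simp only [Set.mem_singleton_iff]
      constructor
      · intro hγ
        obtain ⟨κ, rfl⟩ := (mem_orbit_mk_iff (glInt 2 F)).1 hγ
        rw [mul_one, QuotientGroup.eq, mul_one]
        exact inv_mem κ.2
      · rintro rfl
        exact mem_orbit_self _
    rw [this, Set.ncard_singleton]
    omega
  · rw [ncard_orbit_diag_succ hϖ m, pow_succ]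
    nlinarith [Nat.one_le_iff_ne_zero.mpr (pow_ne_zero m (Nat.card_pos (α := 𝓀[F])).ne')]

end Summit.HodgeConjecture.HodgeConjecture.Cruxes.HLiu418.K2LiuGL2PrimitiveCosetCount

end
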